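import Literature.Probability.LatticeModels.MixedBoundaryHarmonic
import HarnessLib

/-!
# The Dirichlet principle for the discrete mixed Dirichlet–Neumann problem ([LSW04] §4.1)

Topic `Literature/Probability/LatticeModels` (companion of `MixedBoundaryHarmonic.lean`, whose
`Forest.mixedLaplacian H R good` is Lawler–Schramm–Werner's `Δ_{H,E₀,E₁,E₂}`: a finite simple graph
`H`, an absorbing root set `R`, boundary value `1` on the root edges `v → u` with `good v u` and
`0` on the other root edges, the Neumann edges being absent). The **Dirichlet energy** of the mixed
problem,

  `ℰ(f) = ∑_{edges {v,u}, v,u ∉ R} (f u - f v)² + ∑_{v ∉ R} ∑_{u ∈ R, u ∼ v} (b(v,u) - f v)²`,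
  `b(v,u) = 1` if `good v u`, `0` otherwise,

and the energy `ℰ₀` of the same network with zero boundary values, satisfy the exact
**Pythagorean identity** `ℰ(f + w) = ℰ(f) + ℰ₀(w)` whenever `Δ f = 0` off `R`
(`Forest.mixedEnergy_add_of_harmonic`), whence the **Dirichlet principle**: the `Δ`-harmonic
function (LSW's `ĥ`, `Forest.hhat`) minimises `ℰ` among all functions, and
`ℰ(g) - ℰ(ĥ) = ℰ₀(g - ĥ)` measures the distance to the minimiser in energy
(`Forest.mixedEnergy_hhat_le`, `Forest.zeroEnergy_sub_hhat_eq`). This is the classical Dirichlet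
principle for resistor networks (Thomson/Dirichlet; R. Lyons, Y. Peres, *Probability on Trees and
Networks* (2016), §2.4, Exercise 2.13), in the form needed for energy comparisons between the
discrete mixed problem of [LSW04] Prop. 4.1 and its continuum limit. Everything is proved.

## References

* G. F. Lawler, O. Schramm, W. Werner, Ann. Probab. 32 (2004), §4.1 (p. 973).
  [LawlerSchrammWerner2004]
* R. Lyons, Y. Peres, *Probability on Trees and Networks*, CUP (2016), §2.4. [LyonsPeres2016]
-/

noncomputable section

open scoped Classical
open Finset

namespace Literature.Probability.LatticeModels

namespace Forest

variable {V : Type*} [Fintype V] [DecidableEq V]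
variable (H : SimpleGraph V) (R : Finset V) (good : V → V → Prop)

/-- The boundary value on the root edge `v → u`: `1` if good, `0` otherwise. [folklore] -/
def rootValue (v u : V) : ℝ := if good v u then 1 else 0

/-- **The Dirichlet energy of the mixed problem**: interior edges (counted once, as half the
oriented double sum) plus root edges with their boundary values. Values of `f` on `R` are never
read. [cite: LyonsPeres2016, §2.4] -/
def mixedEnergy (f : V → ℝ) : ℝ :=
  ∑ v ∈ univ.filter (· ∉ R),
    ((1 / 2) * ∑ u ∈ (H.neighborFinset v).filter (· ∉ R), (f u - f v) ^ 2 +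
      ∑ u ∈ (H.neighborFinset v).filter (· ∈ R), (rootValue good v u - f v) ^ 2)

/-- **The Dirichlet energy with zero boundary values** on the same network. [cite: LyonsPeres2016, §2.4] -/
def zeroEnergy (w : V → ℝ) : ℝ :=
  ∑ v ∈ univ.filter (· ∉ R),
    ((1 / 2) * ∑ u ∈ (H.neighborFinset v).filter (· ∉ R), (w u - w v) ^ 2 +
      ∑ _u ∈ (H.neighborFinset v).filter (· ∈ R), (w v) ^ 2)

variable {H R good}

/-- The zero-boundary energy is nonnegative. [folklore] -/
theorem zeroEnergy_nonneg (w : V → ℝ) : 0 ≤ zeroEnergy H R w := by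
  unfold zeroEnergy
  refine sum_nonneg fun v _ ↦ add_nonneg ?_ (sum_nonneg fun _ _ ↦ sq_nonneg _)
  exact mul_nonneg (by norm_num) (sum_nonneg fun u _ ↦ sq_nonneg _)

/-- The mixed energy is nonnegative. [folklore] -/
theorem mixedEnergy_nonneg (f : V → ℝ) : 0 ≤ mixedEnergy H R good f := by
  unfold mixedEnergy
  refine sum_nonneg fun v _ ↦ add_nonneg ?_ (sum_nonneg fun u _ ↦ sq_nonneg _)
  exact mul_nonneg (by norm_num) (sum_nonneg fun u _ ↦ sq_nonneg _)

/-- The mixed Laplacian split into its interior and root parts. [folklore] -/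
theorem mixedLaplacian_eq_sum_add_sum (f : V → ℝ) (v : V) :
    mixedLaplacian H R good f v =
      ∑ u ∈ (H.neighborFinset v).filter (· ∉ R), (f u - f v) +
        ∑ u ∈ (H.neighborFinset v).filter (· ∈ R), (rootValue good v u - f v) := by
  rw [mixedLaplacian, add_comm, ← sum_filter_add_sum_filter_not (H.neighborFinset v) (· ∈ R)]
  congr 1
  · refine sum_congr rfl fun u hu ↦ ?_
    rw [(mem_filter.1 hu).2 |> if_pos, rootValue]
  · refine sum_congr rfl fun u hu ↦ ?_
    rw [if_neg (mem_filter.1 hu).2]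

/-- **Symmetric double sums over interior oriented edges can be swapped.** [folklore] -/
theorem sum_sum_interior_comm (F : V → V → ℝ) :
    ∑ v ∈ univ.filter (· ∉ R), ∑ u ∈ (H.neighborFinset v).filter (· ∉ R), F v u =
      ∑ v ∈ univ.filter (· ∉ R), ∑ u ∈ (H.neighborFinset v).filter (· ∉ R), F u v := by
  rw [Finset.sum_comm' (t' := univ.filter (· ∉ R)) (s' := fun u ↦ (H.neighborFinset u).filter (· ∉ R))]
  intro v u
  simp only [mem_filter, mem_univ, true_and, SimpleGraph.mem_neighborFinset]
  constructor
  · rintro ⟨hv, hadj, hu⟩; exact ⟨⟨hadj.symm, hv⟩, hu⟩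
  · rintro ⟨⟨hadj, hv⟩, hu⟩; exact ⟨hv, hadj.symm, hu⟩

/-- **The Pythagorean identity of the Dirichlet principle**: if `Δ f = 0` off `R` then
`ℰ(f + w) = ℰ(f) + ℰ₀(w)` for every `w`. (Expand the squares; the cross term is
`-2 ∑_{v ∉ R} w(v) Δf(v) = 0`, using the symmetry of the interior double sum.)
[cite: LyonsPeres2016, §2.4 (Dirichlet principle)] -/
theorem mixedEnergy_add_of_harmonic {f : V → ℝ} (hf : ∀ v, v ∉ R → mixedLaplacian H R good f v = 0)
    (w : V → ℝ) :
    mixedEnergy H R good (fun v ↦ f v + w v) = mixedEnergy H R good f + zeroEnergy H R w := by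
  -- the cross term
  set X : ℝ := ∑ v ∈ univ.filter (· ∉ R),
      (∑ u ∈ (H.neighborFinset v).filter (· ∉ R), (f u - f v) * (w u - w v) +
        2 * ∑ u ∈ (H.neighborFinset v).filter (· ∈ R), (rootValue good v u - f v) * (-w v)) with hX
  have hexp : mixedEnergy H R good (fun v ↦ f v + w v) =
      mixedEnergy H R good f + zeroEnergy H R w + X := by
    simp only [mixedEnergy, zeroEnergy, hX, ← sum_add_distrib]
    refine sum_congr rfl fun v _ ↦ ?_
    rw [mul_sum, mul_sum, mul_sum]
    have hA : ∑ u ∈ (H.neighborFinset v).filter (· ∉ R), 1 / 2 * (f u + w u - (f v + w v)) ^ 2 =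
        ∑ u ∈ (H.neighborFinset v).filter (· ∉ R), 1 / 2 * (f u - f v) ^ 2 +
          ∑ u ∈ (H.neighborFinset v).filter (· ∉ R), 1 / 2 * (w u - w v) ^ 2 +
          ∑ u ∈ (H.neighborFinset v).filter (· ∉ R), (f u - f v) * (w u - w v) := by
      rw [← sum_add_distrib, ← sum_add_distrib]
      refine sum_congr rfl fun u _ ↦ ?_; ring
    have hB : ∑ u ∈ (H.neighborFinset v).filter (· ∈ R), (rootValue good v u - (f v + w v)) ^ 2 =
        ∑ u ∈ (H.neighborFinset v).filter (· ∈ R), (rootValue good v u - f v) ^ 2 +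
          ∑ u ∈ (H.neighborFinset v).filter (· ∈ R), (w v) ^ 2 +
          2 * ∑ u ∈ (H.neighborFinset v).filter (· ∈ R), (rootValue good v u - f v) * (-w v) := by
      rw [mul_sum, ← sum_add_distrib, ← sum_add_distrib]
      refine sum_congr rfl fun u _ ↦ ?_; ring
    rw [hA, hB]; ring
  -- the interior part of the cross term, symmetrised
  have hint : ∑ v ∈ univ.filter (· ∉ R), ∑ u ∈ (H.neighborFinset v).filter (· ∉ R),
      (f u - f v) * (w u - w v) =
      -2 * ∑ v ∈ univ.filter (· ∉ R), w v * ∑ u ∈ (H.neighborFinset v).filter (· ∉ R), (f u - f v) := by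
    have hswap := sum_sum_interior_comm (H := H) (R := R) (fun v u ↦ (f u - f v) * w u)
    -- `∑∑ (f u - f v) w u = ∑∑ (f v - f u) w v = -∑∑ (f u - f v) w v`
    have h1 : ∑ v ∈ univ.filter (· ∉ R), ∑ u ∈ (H.neighborFinset v).filter (· ∉ R),
        (f u - f v) * w u = -∑ v ∈ univ.filter (· ∉ R), ∑ u ∈ (H.neighborFinset v).filter (· ∉ R),
          (f u - f v) * w v := by
      rw [hswap, ← sum_neg_distrib]
      refine sum_congr rfl fun v _ ↦ ?_
      rw [← sum_neg_distrib]
      refine sum_congr rfl fun u _ ↦ ?_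
      ring
    calc ∑ v ∈ univ.filter (· ∉ R), ∑ u ∈ (H.neighborFinset v).filter (· ∉ R), (f u - f v) * (w u - w v)
        = ∑ v ∈ univ.filter (· ∉ R), ∑ u ∈ (H.neighborFinset v).filter (· ∉ R), (f u - f v) * w u -
          ∑ v ∈ univ.filter (· ∉ R), ∑ u ∈ (H.neighborFinset v).filter (· ∉ R), (f u - f v) * w v := by
          rw [← sum_sub_distrib]
          refine sum_congr rfl fun v _ ↦ ?_
          rw [← sum_sub_distrib]
          refine sum_congr rfl fun u _ ↦ ?_
          ring
      _ = -2 * ∑ v ∈ univ.filter (· ∉ R), w v * ∑ u ∈ (H.neighborFinset v).filter (· ∉ R), (f u - f v) := by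
          rw [h1, mul_sum]
          have : ∀ v ∈ univ.filter (· ∉ R), ∑ u ∈ (H.neighborFinset v).filter (· ∉ R), (f u - f v) * w v =
              w v * ∑ u ∈ (H.neighborFinset v).filter (· ∉ R), (f u - f v) := fun v _ ↦ by
            rw [mul_sum]; refine sum_congr rfl fun u _ ↦ ?_; ring
          rw [sum_congr rfl this]
          rw [← sum_neg_distrib, ← sum_sub_distrib]
          · refine sum_congr rfl fun v _ ↦ ?_; ring
  have hX0 : X = 0 := by
    rw [hX, sum_add_distrib, hint, mul_sum, ← sum_add_distrib]
    refine sum_eq_zero fun v hv ↦ ?_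
    have hv' : v ∉ R := (mem_filter.1 hv).2
    have h := hf v hv'
    rw [mixedLaplacian_eq_sum_add_sum] at h
    have : ∑ u ∈ (H.neighborFinset v).filter (· ∈ R), (rootValue good v u - f v) * (-w v) =
        -(w v) * ∑ u ∈ (H.neighborFinset v).filter (· ∈ R), (rootValue good v u - f v) := by
      rw [mul_sum]; refine sum_congr rfl fun u _ ↦ ?_; ring
    rw [this]
    have h2 : ∑ u ∈ (H.neighborFinset v).filter (· ∈ R), (rootValue good v u - f v) =
        -∑ u ∈ (H.neighborFinset v).filter (· ∉ R), (f u - f v) := by linarith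
    rw [h2]; ring
  rw [hexp, hX0, add_zero]

/-- **The Dirichlet principle: the distance to the minimiser in energy.** For LSW's `Δ`-harmonic
`ĥ` and any `g`, `ℰ(g) = ℰ(ĥ) + ℰ₀(g - ĥ)`. [cite: LyonsPeres2016, §2.4 (Dirichlet principle)] -/
theorem mixedEnergy_eq_add_zeroEnergy_sub_hhat (g : V → ℝ) :
    mixedEnergy H R good g =
      mixedEnergy H R good (hhat H R good) + zeroEnergy H R (fun v ↦ g v - hhat H R good v) := by
  have h := mixedEnergy_add_of_harmonic (H := H) (R := R) (good := good)
    (f := hhat H R good) (fun v hv ↦ mixedLaplacian_hhat hv) (fun v ↦ g v - hhat H R good v)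
  have heq : (fun v ↦ hhat H R good v + (g v - hhat H R good v)) = g := by
    funext v; ring
  rwa [heq] at h

/-- **The Dirichlet principle**: LSW's `ĥ` minimises the mixed Dirichlet energy among all
functions. [cite: LyonsPeres2016, §2.4 (Dirichlet principle)] -/
theorem mixedEnergy_hhat_le (g : V → ℝ) :
    mixedEnergy H R good (hhat H R good) ≤ mixedEnergy H R good g := by
  rw [mixedEnergy_eq_add_zeroEnergy_sub_hhat g]
  linarith [zeroEnergy_nonneg (H := H) (R := R) (fun v ↦ g v - hhat H R good v)]

/-- The energy excess of a competitor is exactly the zero-boundary energy of its difference with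
`ĥ`. [cite: LyonsPeres2016, §2.4 (Dirichlet principle)] -/
theorem zeroEnergy_sub_hhat_eq (g : V → ℝ) :
    zeroEnergy H R (fun v ↦ g v - hhat H R good v) =
      mixedEnergy H R good g - mixedEnergy H R good (hhat H R good) := by
  rw [mixedEnergy_eq_add_zeroEnergy_sub_hhat g]; ring

end Forest

end Literature.Probability.LatticeModels
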